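import Summits.AtomisticToContinuum.Crystallization.Theses.PerronTransitivity
import Literature.MathematicalPhysics.StatisticalMechanics.LocalMatchingCompactness
import Literature.MathematicalPhysics.StatisticalMechanics.LocalLimitOfGroundStates

/-!
# Crux `TransitiveLocalLimit` (stmt-AtomisticToContinuum-15100), line `birth` — stub `stub_centredLocalLimit`

STUB 3 of the skeleton `Cruxes/TransitiveLocalLimit/Lines/birth.lean` (CENTRED EXTRACTION; pure
point-set compactness and counting, no energetics): a uniformly `δ`-separated sequence of finite
configurations `x N` in `ℝ³` whose site energies concentrate IN DENSITY at a level `L`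
(`#{i : θ < |𝓔ⁱ(x N) − L|}/N → 0` for every `θ > 0`) has, along a subsequence `σ` and after
translations `τ j`, a NON-EMPTY uniformly discrete local limit `X` (two-way `ε`-matching on every ball
`‖·‖ ≤ R`, eventually in `j`) such that for every radius `R` and tolerance `θ > 0`, eventually every
translated particle in the `R`-ball has site energy within `θ` of `L`.

Proof (the site energies enter only as real labels `a N i := |𝓔ⁱ(x N) − L|`; the extraction is
`exists_centredLocalLimit`).
* GOOD CENTRES. Particle `i` of `x N` is good at level `k` if every particle within distance `k + 1`
  of it has label `≤ 1/(k+1)`; goodness descends to lower levels. A bad particle (label `> 1/(k+1)`)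
  spoils only the centres within `k + 1` of it, at most `(2(k+1)/δ + 1)^3` of them (packing bound
  `card_le_of_separated_of_dist_le`), so the spoiled centres have density `→ 0` and level `k` is
  achieved eventually in `N` (`eventually_exists_goodCentre`).
* DIAGONAL LEVEL. `K N := Nat.findGreatest (level · achieved at N) N`: for every `k`, eventually
  `k ≤ K N` and level `K N` is achieved (`exists_diagonal_level`); centre `x N` at a particle `i₀` good
  at level `K N` (translation `−x N i₀`).
* EXTRACTION. The translated point sets are `δ`-separated; `exists_subseq_forall_eventually_ballMatch`
  (LocalMatchingCompactness.lean) gives `σ` and a `δ`-separated local limit `X`; the matching clause is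
  `BallMatch` unfolded (`ballMatch_zero_range_iff`).
* NON-EMPTY. The centre `0` of a late translated configuration is matched (radius `0`, tolerance `1`)
  to a point of `X`.
* GOODNESS. Given `R` and `θ > 0` take `k ≥ max R (1/θ)`; eventually `k ≤ K (σ j)`, so the centre is
  good at level `k`: every translated particle of norm `≤ R ≤ k + 1` has label `≤ 1/(k+1) ≤ θ`.
-/

noncomputable section

namespace Summit.AtomisticToContinuum.Crystallization.Theorems.TransitiveLocalLimitBirth

open Literature.MathematicalPhysics.StatisticalMechanics Filter Metric

/-! ## Counting: a bad particle spoils boundedly many centres -/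

/-- In a `δ`-separated finite configuration `y` (`δ > 0`) the particles within distance `r ≥ 0` of a
point `p` number at most `(2r/δ + 1)^{dim}`: the packing bound `card_le_of_separated_of_dist_le`
applied to the image finset (`y` is injective by separation). -/
theorem card_filter_dist_le_of_separated {d N : ℕ} (y : Fin N → EuclideanSpace ℝ (Fin d))
    {δ : ℝ} (hδ : 0 < δ) (hsep : ∀ i j, i ≠ j → δ ≤ dist (y i) (y j))
    (p : EuclideanSpace ℝ (Fin d)) {r : ℝ} (hr : 0 ≤ r) :
    ((Finset.univ.filter fun i => dist (y i) p ≤ r).card : ℝ) ≤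
      (2 * r / δ + 1) ^ Module.finrank ℝ (EuclideanSpace ℝ (Fin d)) := by
  classical
  have hinj : Function.Injective y := by
    intro i j hij
    by_contra h
    have h1 := hsep i j h
    rw [hij, dist_self] at h1
    exact absurd h1 (not_le.2 hδ)
  rw [← Finset.card_image_of_injective _ hinj]
  refine card_le_of_separated_of_dist_le _ p hδ hr ?_ ?_
  · intro c hc
    rw [Finset.mem_image] at hc
    obtain ⟨i, hi, rfl⟩ := hc
    exact (Finset.mem_filter.1 hi).2
  · intro c hc c' hc' hcc'
    rw [Finset.mem_image] at hc hc'
    obtain ⟨i, -, rfl⟩ := hc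
    obtain ⟨j, -, rfl⟩ := hc'
    exact hsep i j fun h => hcc' (congrArg y h)

/-- A bad particle spoils boundedly many centres: in a `δ`-separated finite configuration `y`, the
particles having SOME `bad` particle within distance `r ≥ 0` number at most `(2r/δ + 1)^{dim} · #bad`
(`Finset.card_biUnion_le` and `card_filter_dist_le_of_separated`). -/
theorem card_filter_spoiled_le {d N : ℕ} (y : Fin N → EuclideanSpace ℝ (Fin d)) {δ : ℝ}
    (hδ : 0 < δ) (hsep : ∀ i j, i ≠ j → δ ≤ dist (y i) (y j)) (bad : Fin N → Prop)
    [DecidablePred bad] {r : ℝ} (hr : 0 ≤ r) :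
    ((Finset.univ.filter fun i => ∃ i', bad i' ∧ dist (y i) (y i') ≤ r).card : ℝ) ≤
      (2 * r / δ + 1) ^ Module.finrank ℝ (EuclideanSpace ℝ (Fin d)) *
        (Finset.univ.filter bad).card := by
  classical
  set M : ℝ := (2 * r / δ + 1) ^ Module.finrank ℝ (EuclideanSpace ℝ (Fin d))
  have hsub : (Finset.univ.filter fun i => ∃ i', bad i' ∧ dist (y i) (y i') ≤ r) ⊆
      (Finset.univ.filter bad).biUnion fun i' =>
        Finset.univ.filter fun i => dist (y i) (y i') ≤ r := by
    intro i hi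
    obtain ⟨i', hi', hii'⟩ := (Finset.mem_filter.1 hi).2
    exact Finset.mem_biUnion.2 ⟨i', Finset.mem_filter.2 ⟨Finset.mem_univ _, hi'⟩,
      Finset.mem_filter.2 ⟨Finset.mem_univ _, hii'⟩⟩
  calc ((Finset.univ.filter fun i => ∃ i', bad i' ∧ dist (y i) (y i') ≤ r).card : ℝ)
      ≤ (((Finset.univ.filter bad).biUnion fun i' =>
          Finset.univ.filter fun i => dist (y i) (y i') ≤ r).card : ℝ) := by
        exact_mod_cast Finset.card_le_card hsub
    _ ≤ ∑ i' ∈ Finset.univ.filter bad,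
          ((Finset.univ.filter fun i => dist (y i) (y i') ≤ r).card : ℝ) := by
        exact_mod_cast Finset.card_biUnion_le
    _ ≤ ∑ i' ∈ Finset.univ.filter bad, M :=
        Finset.sum_le_sum fun i' _ => card_filter_dist_le_of_separated y hδ hsep (y i') hr
    _ = M * (Finset.univ.filter bad).card := by
        rw [Finset.sum_const, nsmul_eq_mul, mul_comm]

/-- Density version: along a uniformly `δ`-separated sequence of configurations `x N`, if the `bad N`
particles have density `→ 0`, then so do the particles having a bad particle within distance `r`. -/
theorem tendsto_density_spoiled {d : ℕ} (x : (N : ℕ) → (Fin N → EuclideanSpace ℝ (Fin d)))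
    {δ : ℝ} (hδ : 0 < δ) (hsep : ∀ (N : ℕ) (i j : Fin N), i ≠ j → δ ≤ dist (x N i) (x N j))
    (bad : (N : ℕ) → Fin N → Prop) [∀ N, DecidablePred (bad N)]
    (hbad : Tendsto (fun N : ℕ => ((Finset.univ.filter (bad N)).card : ℝ) / N) atTop (nhds 0))
    {r : ℝ} (hr : 0 ≤ r) :
    Tendsto (fun N : ℕ => ((Finset.univ.filter fun i : Fin N =>
      ∃ i', bad N i' ∧ dist (x N i) (x N i') ≤ r).card : ℝ) / N) atTop (nhds 0) := by
  set M : ℝ := (2 * r / δ + 1) ^ Module.finrank ℝ (EuclideanSpace ℝ (Fin d))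
  have hlim : Tendsto (fun N : ℕ => M * (((Finset.univ.filter (bad N)).card : ℝ) / N)) atTop
      (nhds 0) := by
    simpa only [mul_zero] using hbad.const_mul M
  refine squeeze_zero (fun N => by positivity) (fun N => ?_) hlim
  rw [mul_div_assoc']
  exact div_le_div_of_nonneg_right (card_filter_spoiled_le (x N) hδ (hsep N) (bad N) hr)
    (Nat.cast_nonneg N)

/-- Good centres exist eventually: along a uniformly `δ`-separated sequence of configurations `x N`
with real labels `a N i`, if the particles with `θ < a N i` have density `→ 0`, then eventually in `N`
some particle `i` has ALL particles within distance `r` of it labelled `≤ θ` (the spoiled centres have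
density `→ 0`, eventually `< 1`). -/
theorem eventually_exists_goodCentre {d : ℕ} (x : (N : ℕ) → (Fin N → EuclideanSpace ℝ (Fin d)))
    {δ : ℝ} (hδ : 0 < δ) (hsep : ∀ (N : ℕ) (i j : Fin N), i ≠ j → δ ≤ dist (x N i) (x N j))
    (a : (N : ℕ) → Fin N → ℝ) {θ : ℝ}
    (ha : Tendsto (fun N : ℕ => ((Finset.univ.filter fun i : Fin N => θ < a N i).card : ℝ) / N)
      atTop (nhds 0))
    {r : ℝ} (hr : 0 ≤ r) :
    ∀ᶠ N : ℕ in atTop, ∃ i : Fin N, ∀ i' : Fin N, dist (x N i) (x N i') ≤ r → a N i' ≤ θ := by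
  have h1 := tendsto_density_spoiled x hδ hsep (fun N i => θ < a N i) ha hr
  filter_upwards [h1.eventually_lt_const zero_lt_one, eventually_gt_atTop 0] with N hN hN0
  by_contra hcon
  push Not at hcon
  have hall : (Finset.univ.filter fun i : Fin N =>
      ∃ i', θ < a N i' ∧ dist (x N i) (x N i') ≤ r) = Finset.univ :=
    Finset.filter_true_of_mem fun i _ => let ⟨i', hi1, hi2⟩ := hcon i; ⟨i', hi2, hi1⟩
  have hone : (1 : ℝ) ≤ ((Finset.univ.filter fun i : Fin N =>
      ∃ i', θ < a N i' ∧ dist (x N i) (x N i') ≤ r).card : ℝ) / N := by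
    rw [hall, Finset.card_univ, Fintype.card_fin, div_self (Nat.cast_pos.2 hN0).ne']
  exact absurd hN (not_lt.2 hone)

/-! ## The diagonal level -/

/-- Diagonal level: if every level `k` is achieved eventually in `N` (`P k N`), there is a level
function `K` such that for every `k`, eventually in `N`, `k ≤ K N` and level `K N` is achieved at `N`
(`K N := Nat.findGreatest (P · N) N`). -/
theorem exists_diagonal_level {P : ℕ → ℕ → Prop} (hP : ∀ k, ∀ᶠ N in atTop, P k N) :
    ∃ K : ℕ → ℕ, ∀ k, ∀ᶠ N in atTop, k ≤ K N ∧ P (K N) N := by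
  classical
  refine ⟨fun N => Nat.findGreatest (fun k => P k N) N, fun k => ?_⟩
  filter_upwards [hP k, eventually_ge_atTop k] with N hN hkN
  exact ⟨Nat.le_findGreatest (P := fun k => P k N) hkN hN,
    Nat.findGreatest_spec (P := fun k => P k N) hkN hN⟩

/-! ## Centred extraction -/

/-- **Centred extraction** (abstract form of STUB 3, real labels `a N i` in place of
`|𝓔ⁱ(x N) − L|`): a uniformly `δ`-separated sequence of finite configurations `x N` whose labels
concentrate in density at `0` (`#{i : θ < a N i}/N → 0` for every `θ > 0`) has — after translations
`τ j` centring it at a particle good at all levels `k ≤ K(σ j) → ∞`, and along a subsequence `σ` — a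
non-empty `δ`-separated local limit `X` (two-way matching on every ball `‖·‖ ≤ R`, eventually), such
that for every `R` and `θ > 0`, eventually every translated particle in the `R`-ball has label `≤ θ`. -/
theorem exists_centredLocalLimit {d : ℕ} (x : (N : ℕ) → (Fin N → EuclideanSpace ℝ (Fin d)))
    {δ : ℝ} (hδ : 0 < δ) (hsep : ∀ (N : ℕ) (i j : Fin N), i ≠ j → δ ≤ dist (x N i) (x N j))
    (a : (N : ℕ) → Fin N → ℝ)
    (ha : ∀ θ : ℝ, 0 < θ → Tendsto (fun N : ℕ =>
      ((Finset.univ.filter fun i : Fin N => θ < a N i).card : ℝ) / N) atTop (nhds 0)) :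
    ∃ (X : Set (EuclideanSpace ℝ (Fin d))) (σ : ℕ → ℕ) (τ : ℕ → EuclideanSpace ℝ (Fin d)),
      X.Nonempty ∧ (∀ p ∈ X, ∀ q ∈ X, p ≠ q → δ ≤ dist p q) ∧ StrictMono σ ∧
      (∀ R ε : ℝ, 0 < ε → ∀ᶠ j : ℕ in atTop,
        (∀ p ∈ X, ‖p‖ ≤ R → ∃ i : Fin (σ j), dist (x (σ j) i + τ j) p ≤ ε) ∧
        (∀ i : Fin (σ j), ‖x (σ j) i + τ j‖ ≤ R → ∃ p ∈ X, dist (x (σ j) i + τ j) p ≤ ε)) ∧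
      (∀ R θ : ℝ, 0 < θ → ∀ᶠ j : ℕ in atTop, ∀ i : Fin (σ j), ‖x (σ j) i + τ j‖ ≤ R →
        a (σ j) i ≤ θ) := by
  classical
  -- level-`k` goodness of particle `i` of `x N`: its whole `(k+1)`-ball is `1/(k+1)`-good
  obtain ⟨good, hgood⟩ : ∃ good : (k N : ℕ) → Fin N → Prop, ∀ k N i, good k N i ↔
      ∀ i' : Fin N, dist (x N i) (x N i') ≤ (k : ℝ) + 1 → a N i' ≤ 1 / ((k : ℝ) + 1) :=
    ⟨fun k N i => ∀ i' : Fin N, dist (x N i) (x N i') ≤ (k : ℝ) + 1 → a N i' ≤ 1 / ((k : ℝ) + 1),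
      fun _ _ _ => Iff.rfl⟩
  -- goodness descends to lower levels
  have hanti : ∀ (k k' N : ℕ) (i : Fin N), good k N i → k' ≤ k → good k' N i := by
    intro k k' N i hi hk
    rw [hgood] at hi ⊢
    intro i' hd
    have hk0 : (k' : ℝ) ≤ k := Nat.cast_le.2 hk
    have hk1 : (k' : ℝ) + 1 ≤ (k : ℝ) + 1 := by linarith
    have hpos : (0 : ℝ) < (k' : ℝ) + 1 := by positivity
    exact (hi i' (hd.trans hk1)).trans (one_div_le_one_div_of_le hpos hk1)
  -- every level is achieved eventually in `N`
  have hev : ∀ k : ℕ, ∀ᶠ N in atTop, ∃ i : Fin N, good k N i := by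
    intro k
    have hpos : (0 : ℝ) < (k : ℝ) + 1 := by positivity
    filter_upwards [eventually_exists_goodCentre x hδ hsep a (ha _ (one_div_pos.2 hpos)) hpos.le]
      with N hN
    obtain ⟨i, hi⟩ := hN
    exact ⟨i, (hgood k N i).2 hi⟩
  -- the diagonal level `K N`, achieved at `N` and eventually `≥ k` for every `k`
  obtain ⟨K, hK⟩ := exists_diagonal_level hev
  -- the centring translation: `-x N i₀` for a particle `i₀` good at level `K N` (when there is one)
  have hc_ex : ∀ N : ℕ, ∃ c : EuclideanSpace ℝ (Fin d), (∃ i, good (K N) N i) →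
      ∃ i : Fin N, good (K N) N i ∧ x N i + c = 0 := by
    intro N
    by_cases h : ∃ i, good (K N) N i
    · obtain ⟨i, hi⟩ := h
      exact ⟨-x N i, fun _ => ⟨i, hi, add_neg_cancel (x N i)⟩⟩
    · exact ⟨0, fun h' => absurd h' h⟩
  choose ctr hctr using hc_ex
  -- the translated point sets are `δ`-separated: extract a locally convergent subsequence
  have hYsep : ∀ N : ℕ, ∀ p ∈ Set.range (fun i : Fin N => x N i + ctr N),
      ∀ q ∈ Set.range (fun i : Fin N => x N i + ctr N), p ≠ q → δ ≤ dist p q := by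
    rintro N _ ⟨i, rfl⟩ _ ⟨j, rfl⟩ hij
    show δ ≤ dist (x N i + ctr N) (x N j + ctr N)
    rw [dist_add_right]
    exact hsep N i j fun h => hij (by rw [h])
  obtain ⟨φ, X, hφ, hXsep, hlim⟩ :=
    exists_subseq_forall_eventually_ballMatch hδ
      (fun N => Set.range fun i : Fin N => x N i + ctr N) hYsep
  refine ⟨X, φ, fun j => ctr (φ j), ?_, hXsep, hφ, fun R ε hε => ?_, fun R θ hθ => ?_⟩
  · -- non-empty: the centre `0` of a late translated configuration is matched to a point of `X`
    have h0 : ∀ᶠ N in atTop, (0 : EuclideanSpace ℝ (Fin d)) ∈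
        Set.range (fun i : Fin N => x N i + ctr N) := by
      filter_upwards [hK 0] with N hN
      obtain ⟨i, -, hi⟩ := hctr N hN.2
      exact ⟨i, hi⟩
    obtain ⟨j, hj0, hj⟩ := ((hφ.tendsto_atTop.eventually h0).and (hlim 0 1 one_pos)).exists
    obtain ⟨p, hp, -⟩ := hj.2 0 hj0 (dist_self (0 : EuclideanSpace ℝ (Fin d))).le
    exact ⟨p, hp⟩
  · -- two-way matching on balls: `BallMatch` unfolded
    filter_upwards [hlim R ε hε] with j hj
    exact (ballMatch_zero_range_iff (X := X) (fun i : Fin (φ j) => x (φ j) i + ctr (φ j)) ε R).1 hj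
  · -- goodness: late centres are good at a level `k` with `R ≤ k + 1` and `1/(k+1) ≤ θ`
    obtain ⟨k, hk⟩ := exists_nat_ge (max R (1 / θ))
    have hk1 : (k : ℝ) ≤ (k : ℝ) + 1 := le_add_of_nonneg_right zero_le_one
    have hRk : R ≤ (k : ℝ) + 1 := (le_max_left _ _).trans (hk.trans hk1)
    have hθk : 1 / ((k : ℝ) + 1) ≤ θ := by
      rw [one_div_le (by positivity) hθ]
      exact (le_max_right _ _).trans (hk.trans hk1)
    filter_upwards [hφ.tendsto_atTop.eventually (hK k)] with j hj
    obtain ⟨hkK, hex⟩ := hj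
    intro i hi
    obtain ⟨i₀, hi₀, h0⟩ := hctr (φ j) hex
    have hgoodk : good k (φ j) i₀ := hanti _ _ _ i₀ hi₀ hkK
    rw [hgood] at hgoodk
    have hc : ctr (φ j) = -x (φ j) i₀ := eq_neg_of_add_eq_zero_right h0
    have hdist : dist (x (φ j) i₀) (x (φ j) i) ≤ (k : ℝ) + 1 := by
      rw [dist_comm, dist_eq_norm, sub_eq_add_neg, ← hc]
      exact le_trans hi hRk
    exact (hgoodk i hdist).trans hθk

/-! ## The registered stub -/

/-- **STUB 3 of `Cruxes/TransitiveLocalLimit/Lines/birth.lean` — CENTRED EXTRACTION** (the registered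
signature, verbatim): a uniformly separated sequence of finite configurations `x N` in `ℝ³` whose
Lennard-Jones site energies concentrate in density at a level `L` has, along a subsequence `σ` and
after translations `τ j`, a NON-EMPTY uniformly discrete local limit `X` (two-way `ε`-matching on
every ball `‖·‖ ≤ R`, eventually in `j`) such that, at every radius `R` and tolerance `θ > 0`,
eventually every translated particle in the `R`-ball has site energy within `θ` of `L`. Immediate from
`exists_centredLocalLimit` with the labels `a N i := |𝓔ⁱ(x N) − L|`. -/
theorem stub_centredLocalLimit : ∀ x : (N : ℕ) → (Fin N → EuclideanSpace ℝ (Fin 3)), (∃ δ : ℝ, 0 < δ ∧ ∀ (N : ℕ) (i j : Fin N), i ≠ j → δ ≤ dist (x N i) (x N j)) → ∀ L : ℝ, (∀ θ : ℝ, 0 < θ → Filter.Tendsto (fun N : ℕ => ((Finset.univ.filter fun i : Fin N => θ < |Literature.MathematicalPhysics.StatisticalMechanics.siteEnergy Literature.MathematicalPhysics.StatisticalMechanics.lennardJones (x N) i - L|).card : ℝ) / N) Filter.atTop (nhds 0)) → ∃ (X : Set (EuclideanSpace ℝ (Fin 3))) (σ : ℕ → ℕ) (τ : ℕ → EuclideanSpace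 ℝ (Fin 3)), X.Nonempty ∧ (∃ δ : ℝ, 0 < δ ∧ ∀ p ∈ X, ∀ q ∈ X, p ≠ q → δ ≤ dist p q) ∧ StrictMono σ ∧ (∀ R ε : ℝ, 0 < ε → ∀ᶠ j : ℕ in Filter.atTop, (∀ p ∈ X, ‖p‖ ≤ R → ∃ i : Fin (σ j), dist (x (σ j) i + τ j) p ≤ ε) ∧ (∀ i : Fin (σ j), ‖x (σ j) i + τ j‖ ≤ R → ∃ p ∈ X, dist (x (σ j) i + τ j) p ≤ ε)) ∧ (∀ R θ : ℝ, 0 < θ → ∀ᶠ j : ℕ in Filter.atTop, ∀ i : Fin (σ j), ‖x (σ j) i + τ j‖ ≤ R → |Literature.MathematicalPhysics.StatisticalMechanics.siteEnergy Literature.MathematicalPhysics.StatisticalMechanics.lennardJones (x (σ j)) i - L| ≤ θ) := by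
  intro x hx L hL
  obtain ⟨δ, hδ, hsep⟩ := hx
  obtain ⟨X, σ, τ, hne, hXsep, hσ, hmatch, hgood⟩ := exists_centredLocalLimit x hδ hsep
    (fun N i => |siteEnergy lennardJones (x N) i - L|) hL
  exact ⟨X, σ, τ, hne, ⟨δ, hδ, hXsep⟩, hσ, hmatch, hgood⟩

end Summit.AtomisticToContinuum.Crystallization.Theorems.TransitiveLocalLimitBirth

end
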